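import Summits.Ventures.CertifiedQuantumChemistry.Rows.V2RDMDualKernelResidual
import HarnessLib

/-!
# Ventures/CertifiedQuantumChemistry — Rows/V2RDMDualKernelBlocks.lean: the D/Q/G/g1/q1 block entries as linear forms, the Gram pairing `Σ (L Lᵀ)_ij Re B_ij ≥ 0`, the weighted block form

HONEST FRAMING (verbatim): certified bounds for a stated model Hamiltonian in a stated basis; not a
claim about the real molecule beyond that model.

PART OF `Rows/V2RDMDualKernel.lean` (rdm-A g61, KERNEL-SDP): the kernel-replayed v2RDM dual SDP certificate ⇒ `LowerRow`.
The development is split into `Rows/V2RDMDualKernelTerms.lean` → `…Residual.lean` → `…Blocks.lean`, `…Pack.lean` → `Rows/V2RDMDualKernel.lean`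
(the entry points `lowerRow_of_check` / `lowerRow_of_staged` and the full account live in the last file); one namespace
`Summit.Ventures.CertifiedQuantumChemistry.V2RDMDual` throughout, so declaration names do not depend on the file split.
-/

namespace Summit.Ventures.CertifiedQuantumChemistry

open Matrix Finset
open scoped ComplexOrder
open Literature.MathematicalPhysics.QuantumLattice Literature.MathematicalPhysics.QuantumChemistry

namespace V2RDMDual

section Semantics

variable {k : ℕ} [NeZero k] {γ : M1 k} {Γ : M2 k}

/-! ## The PSD blocks: entry forms and their values -/

/-- Block kinds of the DQG programme: `¹D`, `¹Q = 1 − γᵀ`, `²D = Γ`, `²Q = qMap`, `²G = gMap`. -/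
inductive BKind where
  | g1 | q1 | d2 | q2 | g2
  deriving DecidableEq, Repr, Inhabited

/-- Kronecker delta on naturals as a rational. -/
def dlt (i j : ℕ) : ℚ := if i = j then 1 else 0

/-- The linear form (constant, terms) of the block entry `(I, J)`; one-index kinds use `.1` only. -/
def entry : BKind → ℕ × ℕ → ℕ × ℕ → Row
  | .g1, I, J => (0, [(1, .one I.1 J.1)])
  | .q1, I, J => (dlt I.1 J.1, [(-1, .one J.1 I.1)])
  | .d2, I, J => (0, [(1, .two I.1 I.2 J.1 J.2)])
  | .q2, I, J => (dlt I.1 J.1 * dlt I.2 J.2 - dlt I.1 J.2 * dlt I.2 J.1,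
      [(-dlt I.2 J.2, .one J.1 I.1), (dlt I.2 J.1, .one J.2 I.1), (dlt I.1 J.2, .one J.1 I.2),
       (-dlt I.1 J.1, .one J.2 I.2), (1, .two J.1 J.2 I.1 I.2)])
  | .g2, I, J => (0, [(dlt I.2 J.2, .one I.1 J.1), (-1, .two I.1 J.2 J.1 I.2)])

/-- The matrix entry a block kind denotes at `(γ, Γ)`. -/
def BKind.mat (κ : BKind) (γ : M1 k) (Γ : M2 k) (I J : ℕ × ℕ) : ℂ :=
  match κ with
  | .g1 => γ (so k I.1) (so k J.1)
  | .q1 => (1 - γᵀ) (so k I.1) (so k J.1)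
  | .d2 => Γ (so k I.1, so k I.2) (so k J.1, so k J.2)
  | .q2 => qMap γ Γ (so k I.1, so k I.2) (so k J.1, so k J.2)
  | .g2 => gMap γ Γ (so k I.1, so k I.2) (so k J.1, so k J.2)

/-- Index validity (both components below `2k`), needed to read the Kronecker deltas off the numbering. -/
def validIdx (n : ℕ) (I : ℕ × ℕ) : Bool := decide (I.1 < n) && decide (I.2 < n)

/-- Real part of an indicator in `ℂ`. -/
theorem re_ite_one_zero (P : Prop) [Decidable P] : (if P then (1 : ℂ) else 0).re = if P then 1 else 0 := by
  split_ifs <;> simp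

/-- The entry form of block kind `κ` at valid indices evaluates to the real part of that block-matrix entry. -/
theorem entry_val (κ : BKind) {I J : ℕ × ℕ} (hI : validIdx (2 * k) I = true) (hJ : validIdx (2 * k) J = true) :
    rowVal (k := k) (γ := γ) (Γ := Γ) (entry κ I J) = (κ.mat γ Γ I J).re := by
  simp only [validIdx, Bool.and_eq_true, decide_eq_true_eq] at hI hJ
  have e11 := so_eq_iff (k := k) hI.1 hJ.1
  have e12 := so_eq_iff (k := k) hI.1 hJ.2
  have e21 := so_eq_iff (k := k) hI.2 hJ.1
  have e22 := so_eq_iff (k := k) hI.2 hJ.2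
  cases κ with
  | g1 => simp [rowVal, entry, BKind.mat, Desc.val]
  | q1 =>
    simp only [rowVal, entry, BKind.mat, Desc.val, termsVal_cons, termsVal_nil, Matrix.sub_apply, Matrix.one_apply,
      Matrix.transpose_apply, Complex.sub_re, e11, dlt, re_ite_one_zero]
    split_ifs <;> push_cast <;> ring
  | d2 => simp [rowVal, entry, BKind.mat, Desc.val]
  | q2 =>
    simp only [rowVal, entry, BKind.mat, Desc.val, termsVal_cons, termsVal_nil, qMap, Complex.sub_re, Complex.add_re,
      Complex.mul_re, e11, e12, e21, e22, dlt, apply_ite Complex.re,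
      apply_ite Complex.im, Complex.one_re, Complex.one_im, Complex.zero_re, Complex.zero_im]
    push_cast
    split_ifs <;> simp <;> ring
  | g2 =>
    simp only [rowVal, entry, BKind.mat, Desc.val, termsVal_cons, termsVal_nil, gMap, Complex.sub_re, e22, dlt,
      apply_ite Complex.re, Complex.zero_re]
    push_cast
    split_ifs <;> simp
    ring

/-- Every DQG block kind denotes a positive semidefinite matrix on any member family. -/
theorem BKind.mat_posSemidef (κ : BKind) {N : ℕ} (h : IsDQGFeasible N γ Γ) (hr : N + 2 ≤ Fintype.card (Orb (Fin k)))
    {d : ℕ} (m : Fin d → ℕ × ℕ) : (Matrix.of fun i j : Fin d => κ.mat γ Γ (m i) (m j)).PosSemidef := by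
  cases κ with
  | g1 => exact h.one_posSemidef.submatrix fun i => so k (m i).1
  | q1 => exact (h.oneHole_posSemidef hr).submatrix fun i => so k (m i).1
  | d2 => exact h.d_psd.submatrix fun i => (so k (m i).1, so k (m i).2)
  | q2 => exact h.q_psd.submatrix fun i => (so k (m i).1, so k (m i).2)
  | g2 => exact h.g_psd.submatrix fun i => (so k (m i).1, so k (m i).2)

/-! ## Gram pairing: `Σ_ij (L Lᵀ)_ij Re B_ij ≥ 0` for `B ⪰ 0` -/

/-- Inner product of two integer lists (the shorter zero-padded). -/
def dotZ : List ℤ → List ℤ → ℤ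
  | a :: as, b :: bs => a * b + dotZ as bs
  | _, _ => 0

/-- Head/tail expansion of the integer dot product. -/
theorem dotZ_eq_head_tail (as bs : List ℤ) :
    dotZ as bs = as.headD 0 * bs.headD 0 + dotZ as.tail bs.tail := by
  cases as with
  | nil => cases bs <;> simp [dotZ]
  | cons a as => cases bs <;> simp [dotZ]

/-- Gram pairing: for `B ⪰ 0` and integer factor rows `r`, `Σ_ij ⟨r_i, r_j⟩ · Re B_ij ≥ 0`. -/
theorem gram_pairing_nonneg {d : ℕ} {B : Matrix (Fin d) (Fin d) ℂ} (hB : B.PosSemidef) :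
    ∀ (r : Fin d → List ℤ), 0 ≤ ∑ i, ∑ j, (dotZ (r i) (r j) : ℝ) * (B i j).re := by
  suffices H : ∀ (n : ℕ) (r : Fin d → List ℤ), ∑ i, (r i).length ≤ n →
      0 ≤ ∑ i, ∑ j, (dotZ (r i) (r j) : ℝ) * (B i j).re from fun r => H _ r le_rfl
  intro n
  induction n with
  | zero =>
    intro r hr
    have h0 : ∀ i, r i = [] := by
      intro i
      have := Finset.sum_eq_zero_iff.mp (Nat.le_zero.mp hr) i (Finset.mem_univ i)
      exact List.eq_nil_of_length_eq_zero this
    simp [h0, dotZ]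
  | succ n ih =>
    intro r hr
    by_cases hall : ∀ i, r i = []
    · simp [hall, dotZ]
    · obtain ⟨i₀, hi₀⟩ : ∃ i, r i ≠ [] := by simpa using hall
      -- split off the head column
      have hsplit : ∑ i, ∑ j, (dotZ (r i) (r j) : ℝ) * (B i j).re =
          (∑ i, ∑ j, ((r i).headD 0 : ℝ) * ((r j).headD 0 : ℝ) * (B i j).re) +
            ∑ i, ∑ j, (dotZ ((r i).tail) ((r j).tail) : ℝ) * (B i j).re := by
        rw [← Finset.sum_add_distrib]
        refine Finset.sum_congr rfl fun i _ => ?_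
        rw [← Finset.sum_add_distrib]
        refine Finset.sum_congr rfl fun j _ => ?_
        rw [dotZ_eq_head_tail]; push_cast; ring
      rw [hsplit]
      refine add_nonneg ?_ (ih (fun i => (r i).tail) ?_)
      · -- the rank-one part is `Re ⟨v, B v⟩ ≥ 0`
        have hv := hB.dotProduct_mulVec_nonneg fun i => (((r i).headD 0 : ℤ) : ℂ)
        have hre := (Complex.nonneg_iff.mp hv).1
        have e : (star (fun i => (((r i).headD 0 : ℤ) : ℂ)) ⬝ᵥ B *ᵥ (fun i => (((r i).headD 0 : ℤ) : ℂ))).re =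
            ∑ i, ∑ j, ((r i).headD 0 : ℝ) * ((r j).headD 0 : ℝ) * (B i j).re := by
          simp only [dotProduct, mulVec, Pi.star_apply, Complex.star_def, map_intCast, Finset.mul_sum, Complex.re_sum]
          refine Finset.sum_congr rfl fun i _ => Finset.sum_congr rfl fun j _ => ?_
          simp only [Complex.mul_re, Complex.mul_im, Complex.intCast_re, Complex.intCast_im, mul_zero, sub_zero,
            zero_mul]
          ring
        rw [← e]; exact hre
      · -- total length drops
        have hlt : ∑ i, ((r i).tail).length < ∑ i, (r i).length := by
          apply Finset.sum_lt_sum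
          · intro i _; simp [List.length_tail]
          · refine ⟨i₀, Finset.mem_univ _, ?_⟩
            have : 0 < (r i₀).length := List.length_pos_of_ne_nil hi₀
            simp [List.length_tail]; omega
        omega

/-! ## The block form: all ordered entry pairs, weighted by `−(L Lᵀ)_ij · s` -/

/-- The piece of entry `(i, j)` of a block: nothing if the entry form is identically zero or the Gram entry
vanishes; else `(w · const, w · terms)` with `w = −(L Lᵀ)_ij · s`. -/
def piece (κ : BKind) (mem : List (ℕ × ℕ)) (L : List (List ℤ)) (s : ℚ) (i j : ℕ) : List Row :=
  let e := entry κ (mem.getD i (0, 0)) (mem.getD j (0, 0))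
  if e.1 = 0 ∧ e.2.all (fun t => t.1 = 0) then [] else
  let g := dotZ (L.getD i []) (L.getD j [])
  if g = 0 then [] else
  let w : ℚ := -((g : ℚ) * s)
  [(w * e.1, e.2.map (scale w))]

/-- All pieces of a block (ordered pairs of member positions). -/
def blockPieces (κ : BKind) (mem : List (ℕ × ℕ)) (L : List (List ℤ)) (s : ℚ) : List Row :=
  (List.range mem.length).flatMap fun i => (List.range mem.length).flatMap fun j => piece κ mem L s i j

/-- Member validity of a block. -/
def blockValid (n : ℕ) (mem : List (ℕ × ℕ)) : Bool :=
  (List.range mem.length).all fun i => validIdx n (mem.getD i (0, 0))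

/-- Sum of row values of a list of rows. -/
def rowsVal (rs : List Row) : ℝ := (rs.map (rowVal (k := k) (γ := γ) (Γ := Γ))).sum

/-- The empty row list has value `0`. -/
@[simp] theorem rowsVal_nil : rowsVal (k := k) (γ := γ) (Γ := Γ) [] = 0 := by simp [rowsVal]
/-- Value of a row list peels off its head. -/
@[simp] theorem rowsVal_cons (r : Row) (rs : List Row) :
    rowsVal (k := k) (γ := γ) (Γ := Γ) (r :: rs) = rowVal (k := k) (γ := γ) (Γ := Γ) r + rowsVal (k := k) (γ := γ) (Γ := Γ) rs := by
  simp [rowsVal]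
/-- Row-list value is additive under concatenation. -/
@[simp] theorem rowsVal_append (rs rs' : List Row) :
    rowsVal (k := k) (γ := γ) (Γ := Γ) (rs ++ rs') = rowsVal (k := k) (γ := γ) (Γ := Γ) rs + rowsVal (k := k) (γ := γ) (Γ := Γ) rs' := by
  simp [rowsVal, List.map_append, List.sum_append]

/-- Row-list value of a `flatMap` is the sum over the pieces. -/
theorem rowsVal_flatMap {α : Type*} (l : List α) (f : α → List Row) :
    rowsVal (k := k) (γ := γ) (Γ := Γ) (l.flatMap f) = (l.map fun a => rowsVal (k := k) (γ := γ) (Γ := Γ) (f a)).sum := by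
  induction l with
  | nil => simp
  | cons a l ih => simp [List.flatMap_cons, ih]

/-- A form with all coefficients zero has value `0`. -/
theorem termsVal_eq_zero_of_all {l : List Term} (h : l.all (fun t => t.1 = 0) = true) : termsVal k γ Γ l = 0 := by
  induction l with
  | nil => simp
  | cons t l ih =>
    simp only [List.all_cons, Bool.and_eq_true, decide_eq_true_eq] at h
    simp [h.1, ih h.2]

/-- The value of one weighted block piece: `-(L Lᵀ)_ij · s` times the real part of the block entry. -/
theorem piece_val (κ : BKind) (mem : List (ℕ × ℕ)) (L : List (List ℤ)) (s : ℚ) {i j : ℕ}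
    (hi : validIdx (2 * k) (mem.getD i (0, 0)) = true) (hj : validIdx (2 * k) (mem.getD j (0, 0)) = true) :
    rowsVal (k := k) (γ := γ) (Γ := Γ) (piece κ mem L s i j) =
      -((dotZ (L.getD i []) (L.getD j []) : ℝ) * s) * (κ.mat γ Γ (mem.getD i (0, 0)) (mem.getD j (0, 0))).re := by
  have hev := entry_val (k := k) (γ := γ) (Γ := Γ) κ hi hj
  unfold piece
  simp only
  split_ifs with h0 hg
  · rw [rowVal, h0.1, termsVal_eq_zero_of_all h0.2] at hev
    simp only [Rat.cast_zero, add_zero] at hev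
    rw [← hev]; simp
  · rw [hg]; simp
  · rw [rowsVal_cons, rowsVal_nil, add_zero, rowVal, termsVal_map_scale, ← hev, rowVal]
    push_cast; ring

/-- Weak duality for one PSD block: the weighted block form has nonpositive value on the feasible set (`s ≥ 0`). -/
theorem blockPieces_val_le {N : ℕ} (h : IsDQGFeasible N γ Γ) (hr : N + 2 ≤ Fintype.card (Orb (Fin k)))
    (κ : BKind) (mem : List (ℕ × ℕ)) (L : List (List ℤ)) {s : ℚ} (hs : 0 ≤ s)
    (hv : blockValid (2 * k) mem = true) :
    rowsVal (k := k) (γ := γ) (Γ := Γ) (blockPieces κ mem L s) ≤ 0 := by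
  set d := mem.length
  have hv' : ∀ i, i < d → validIdx (2 * k) (mem.getD i (0, 0)) = true := by
    intro i hi
    simp only [blockValid, List.all_eq_true, List.mem_range] at hv
    exact hv i hi
  -- evaluate the pieces
  have e : rowsVal (k := k) (γ := γ) (Γ := Γ) (blockPieces κ mem L s) =
      -(s : ℝ) * ∑ i : Fin d, ∑ j : Fin d, (dotZ (L.getD i []) (L.getD j []) : ℝ) *
        (κ.mat γ Γ (mem.getD i (0, 0)) (mem.getD j (0, 0))).re := by
    rw [blockPieces, rowsVal_flatMap, list_sum_range, Finset.mul_sum, ← Fin.sum_univ_eq_sum_range]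
    refine Finset.sum_congr rfl fun i _ => ?_
    rw [rowsVal_flatMap, list_sum_range, Finset.mul_sum, ← Fin.sum_univ_eq_sum_range]
    refine Finset.sum_congr rfl fun j _ => ?_
    rw [piece_val κ mem L s (hv' i i.isLt) (hv' j j.isLt)]
    ring
  rw [e]
  have hG := gram_pairing_nonneg (d := d)
    (B := Matrix.of fun i j : Fin d => κ.mat γ Γ (mem.getD i (0, 0)) (mem.getD j (0, 0)))
    (BKind.mat_posSemidef (k := k) (γ := γ) (Γ := Γ) κ h hr (fun i : Fin d => mem.getD i (0, 0))) (fun i => L.getD i [])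
  simp only [Matrix.of_apply] at hG
  have hs' : (0 : ℝ) ≤ s := by exact_mod_cast hs
  nlinarith

end Semantics

end V2RDMDual

end Summit.Ventures.CertifiedQuantumChemistry
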